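import Literature.AlgebraicTopology.SingularHomology.NoncompactManifoldProofs
import Literature.AlgebraicTopology.SingularHomology.FundamentalClassExistence
import Literature.AlgebraicTopology.SingularHomology.OrientationProofs
import Literature.AlgebraicTopology.SingularHomology.SingularChains
import Mathlib.Topology.Homotopy.Equiv
import HarnessLib

/-!
# Programme TOP, brick C (pure topology): a surface homotopy equivalent to a space retracting
# onto a closed surface is compact

Crux `HawkingExtensionIsKerr` (stmt-FinalStateConjecture-17840), line `SketchIdeator2`, stub
`stub_top_sigmaCompact` (a sub-goal of the lead's `stub_top_slice`).  In the application `E` is the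
event horizon `𝓔⁺`, `Sg` its `T`-slice `Σ` (a connected Hausdorff `C⁰` surface, homotopy equivalent
to `𝓔⁺` by the deformation retraction along the stationary orbits) and `B` the compact `C⁰`
cross-section `∂S̄` of the generators, a retract of `𝓔⁺`; but the statement proved here is a closed
statement of singular homology with no geometry in it:

* `E` any topological space, `B` a closed (compact, Hausdorff) connected topological surface which
  is a retract of `E` (`i : C(B, E)`, `r : C(E, B)`, `r ∘ i = id`), `Sg` a connected Hausdorff
  topological surface homotopy equivalent to `E`.  **Then `Sg` is compact.**

Proof (mod-2 homology in degree 2).  `H₂(B; 𝔽₂) ≅ 𝔽₂ ≠ 0` since `B` is a closed connected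
surface with its `𝔽₂`-orientation (A. Hatcher, *Algebraic Topology* (2002), §3.3, Thm. 3.26(a) and
p. 235: `nonempty_singularHomology_top_iso_holds`, `nonempty_homologicalOrientation_zmod_two`);
`i_* : H₂(B) → H₂(E)` is a split monomorphism (`r_* ∘ i_* = (r ∘ i)_* = 𝟙`), and
`H₂(E) ≅ H₂(Sg)` by homotopy invariance (Hatcher Cor. 2.11, `singularHomology.isoOfHomotopyEquiv`).
If `Sg` were not compact it would be a connected non-compact surface, so `H₂(Sg; 𝔽₂) = 0`
(Hatcher Prop. 3.29, `isZero_singularHomology_of_noncompactSpace_holds`), hence `H₂(E; 𝔽₂) = 0`,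
`i_* = 0`, `𝟙_{H₂(B)} = i_* ≫ r_* = 0` and `H₂(B; 𝔽₂) = 0` — a contradiction.

## References

* A. Hatcher, *Algebraic Topology*, CUP 2002, §2.1 Cor. 2.11, §3.3 Thm. 3.26(a), p. 235,
  Prop. 3.29. [HatcherAT2002]
-/

noncomputable section

-- the tree namespace `Summit.FinalStateConjecture.FinalStateConjecture.…` repeats a component by design
set_option linter.dupNamespace false

namespace Summit.FinalStateConjecture.FinalStateConjecture.Theorems.HawkingExtensionIsKerr.SketchIdeator2

open Set Filter Function CategoryTheory Limits Literature.AlgebraicTopology.SingularHomology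
open scoped Manifold Topology

/-- **`H₂(B; 𝔽₂) ≠ 0` for a closed connected surface.**  For a compact Hausdorff connected `B : Type`
charted on `ℝ²`, the mod-2 homology `H₂(B; 𝔽₂)` is not a zero object: every topological manifold is
`𝔽₂`-oriented (Hatcher 2002, §3.3, p. 235) and for a closed connected `R`-oriented `n`-manifold
`Hₙ(X; R) ≅ R` (Hatcher 2002, Thm. 3.26(a)), while `𝔽₂ ≠ 0`.
[cite: HatcherAT2002, §3.3 Thm. 3.26(a)] -/
theorem not_isZero_singularHomology_two_of_closedSurface (B : Type) [TopologicalSpace B]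
    [T2Space B] [CompactSpace B] [ChartedSpace (EuclideanSpace ℝ (Fin 2)) B] [ConnectedSpace B] :
    ¬ IsZero (singularHomology (ZMod 2) (ZMod 2) B 2) := by
  obtain ⟨μ⟩ := (nonempty_homologicalOrientation_zmod_two :
    Nonempty (HomologicalOrientation (ZMod 2) B 2))
  obtain ⟨e⟩ := nonempty_singularHomology_top_iso_holds (R := ZMod 2) (X := B) 2 μ
  intro h
  have h' : Subsingleton (ULift.{0} (ZMod 2)) :=
    ModuleCat.isZero_of_iff_subsingleton.mp (h.of_iso e.symm)
  exact absurd (congrArg ULift.down (Subsingleton.elim (ULift.up (1 : ZMod 2)) (ULift.up 0)))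
    (by decide)

/-- **Retracts inherit non-vanishing homology.**  If `B` is a retract of `E` (`r ∘ i = id`) then
`i_* ≫ r_* = 𝟙` on `Hₙ(·; M)` (functoriality, Hatcher 2002, §2.1, properties (i), (ii) after
Prop. 2.9), so `Hₙ(E; M) = 0` forces `Hₙ(B; M) = 0`. [cite: HatcherAT2002, §2.1 Prop. 2.9 ff.] -/
theorem isZero_singularHomology_of_retract {R : Type} [CommRing R] {M : Type} [AddCommGroup M]
    [Module R M] {E B : Type} [TopologicalSpace E] [TopologicalSpace B] (i : C(B, E)) (r : C(E, B))
    (hri : ∀ b : B, r (i b) = b) (n : ℕ) (hE : IsZero (singularHomology R M E n)) :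
    IsZero (singularHomology R M B n) := by
  have hid : singularHomology.map R M i n ≫ singularHomology.map R M r n = 𝟙 _ := by
    rw [← singularHomology.map_comp]
    have hc : r.comp i = ContinuousMap.id B := ContinuousMap.ext hri
    rw [hc, singularHomology.map_id]
  rw [IsZero.iff_id_eq_zero, ← hid, hE.eq_zero_of_tgt (singularHomology.map R M i n), zero_comp]

/-- **The slice `Σ` is compact** (stub `stub_top_sigmaCompact`).  Let `E` be a topological space,
`B : Type` a compact Hausdorff connected (nonempty) surface charted on `ℝ²` which is a retract of `E`
(`i : C(B, E)`, `r : C(E, B)`, `r ∘ i = id`), and `Sg : Type` a Hausdorff connected surface charted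
on `ℝ²` homotopy equivalent to `E`.  Then `Sg` is compact: otherwise `H₂(Sg; 𝔽₂) = 0`
(Hatcher 2002, Prop. 3.29), so `H₂(E; 𝔽₂) ≅ H₂(Sg; 𝔽₂) = 0` (Cor. 2.11) and the retract `B` has
`H₂(B; 𝔽₂) = 0`, contradicting `H₂(B; 𝔽₂) ≅ 𝔽₂` (Thm. 3.26(a) with the `𝔽₂`-orientation).
[cite: HatcherAT2002, §3.3 Prop. 3.29] -/
theorem stub_top_sigmaCompact : ∀ (E Sg B : Type) [TopologicalSpace E] [TopologicalSpace Sg] [T2Space Sg] [ChartedSpace (EuclideanSpace ℝ (Fin 2)) Sg] [ConnectedSpace Sg] [TopologicalSpace B] [T2Space B] [CompactSpace B] [ChartedSpace (EuclideanSpace ℝ (Fin 2)) B] [ConnectedSpace B] [Nonempty B] (i : C(B, E)) (r : C(E, B)), (∀ b : B, r (i b) = b) → Nonempty (ContinuousMap.HomotopyEquiv Sg E) → CompactSpace Sg := by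
  intro E Sg B _ _ _ _ _ _ _ _ _ _ _ i r hri he
  obtain ⟨e⟩ := he
  by_contra hSg
  haveI : NoncompactSpace Sg := not_compactSpace_iff.mp hSg
  have hz : IsZero (singularHomology (ZMod 2) (ZMod 2) Sg 2) :=
    isZero_singularHomology_of_noncompactSpace_holds (ZMod 2) Sg 2 le_rfl
  have hE : IsZero (singularHomology (ZMod 2) (ZMod 2) E 2) :=
    hz.of_iso (singularHomology.isoOfHomotopyEquiv (ZMod 2) (ZMod 2) e 2).symm
  exact not_isZero_singularHomology_two_of_closedSurface B
    (isZero_singularHomology_of_retract i r hri 2 hE)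

end Summit.FinalStateConjecture.FinalStateConjecture.Theorems.HawkingExtensionIsKerr.SketchIdeator2

end
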